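import Summits.NavierStokesRegularity.NavierStokesRegularity.Theorems.PalasekTowerBreakdownEpisodeBaseAgmonFourier

/-!
# Agmon's inequality on a three-dimensional space with an EXPLICIT constant, II: the Fourier split and
# the optimal radius

Cell `ns-blowup`, seat `ns-palasek-19179-p2` (g6; `--supports stmt-NavierStokesRegularity-19179`; support for the
stub `stub_strain_door` of the line `Cruxes/EpisodeBase/Lines/straindoor.lean`). Sequel of
`PalasekTowerBreakdownEpisodeBaseAgmonFourier.lean` (I). LABEL: E–C analysis (KERNEL: theorems only; no
definition, no named fact, no `sorry`; register-free). WHAT THIS IS NOT: not Navier–Stokes evidence — a Sobolev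
inequality; no flow, run, design or blow-up is exhibited or asserted.

THIS FILE (II):
* `enorm_le_agmon_split` — for `f : E → ℂ` smooth with all derivatives in `L²`, `dim E = 3`, every `R > 0` and
  every `x`: `‖f(x)‖ ≤ (R/π)^{1/2} (∑ᵢ ‖∂ᵢf‖₂²)^{1/2} + (1/(4π³R))^{1/2} (∑ᵢⱼ ‖∂ᵢ∂ⱼf‖₂²)^{1/2}` (in `ℝ≥0∞`):
  `‖f(x)‖ ≤ ∫_{‖ξ‖<R} ‖a‖ + ∫_{‖ξ‖≥R} ‖a‖`, Hölder on each piece with the weights `(2π‖ξ‖)^{∓1}`, `(2π‖ξ‖)^{∓2}`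
  (the origin is a null set), the radial integrals and the weighted Plancherel identities of part I;
* `le_agmon_const_of_forall_radius` — the optimisation in `R`: `t ≤ √(R/π)√g + √(1/(4π³R))√h` for all `R > 0`
  implies `t ≤ (√2/π) √(√g √h)` (`R = √h/(2π√g)`; the degenerate cases by `R → ∞`, `R → 0`);
  `sqrt_sqrt_mul_sqrt_eq_rpow` — `√(√g√h) = (gh)^{1/4}`.

References: J. C. Robinson, J. L. Rodrigo, W. Sadowski, CUP 2016, Thm. 1.20 [cite: RobinsonRodrigoSadowski2016, Thm. 1.20];
E. M. Stein, G. Weiss, Princeton 1971, Ch. I Thm. 2.3 [cite: SteinWeiss1971, Ch. I Thm. 2.3].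
-/

noncomputable section

set_option linter.dupNamespace false

open MeasureTheory Filter Function Set Metric
open Literature.Analysis.FunctionSpaces
open scoped ENNReal NNReal RealInnerProductSpace Topology FourierTransform ContDiff

namespace Summit.NavierStokesRegularity.NavierStokesRegularity.Theorems.AgmonExplicit

variable {E : Type*} [NormedAddCommGroup E] [InnerProductSpace ℝ E] [FiniteDimensional ℝ E]
  [MeasurableSpace E] [BorelSpace E]

/-! ## §3 Assembly: the two-radius (Fourier-split) form of Agmon's inequality in dimension three -/

section Assembly

variable {f : E → ℂ}

/-- **Agmon's inequality on a three-dimensional space, Fourier-split form with an explicit radius.** For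
`f : E → ℂ` smooth with all derivatives in `L²`, `dim E = 3`, every `R > 0` and every `x`:
`‖f(x)‖ ≤ (R/π)^{1/2} (∑ᵢ ‖∂ᵢf‖₂²)^{1/2} + (1/(4π³R))^{1/2} (∑ᵢⱼ ‖∂ᵢ∂ⱼf‖₂²)^{1/2}`
(`‖f(x)‖ ≤ ∫_{‖ξ‖<R} ‖a‖ + ∫_{‖ξ‖≥R} ‖a‖`, Cauchy–Schwarz with the weights `(2π‖ξ‖)^{∓1}`, `(2π‖ξ‖)^{∓2}`,
`∫_{‖ξ‖<R} ‖ξ‖⁻² = 4πR`, `∫_{‖ξ‖≥R} ‖ξ‖⁻⁴ = 4π/R`, and the weighted Plancherel identities).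
[cite: SteinWeiss1971, Ch. I Thm. 2.3] -/
theorem enorm_le_agmon_split (h3 : Module.finrank ℝ E = 3) (hf : ContDiff ℝ ∞ f)
    (hn : ∀ n : ℕ, ∫⁻ x, ‖iteratedFDeriv ℝ n f x‖ₑ ^ 2 < ⊤) {R : ℝ} (hR : 0 < R) (x : E) :
    ‖f x‖ₑ ≤
      ENNReal.ofReal (R / Real.pi) ^ (1 / 2 : ℝ) *
          (∑ i, ∫⁻ y, ‖fderiv ℝ f y (stdOrthonormalBasis ℝ E i)‖ₑ ^ 2) ^ (1 / 2 : ℝ) +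
        ENNReal.ofReal (1 / (4 * Real.pi ^ 3 * R)) ^ (1 / 2 : ℝ) *
          (∑ i, ∑ j, ∫⁻ y, ‖fderiv ℝ (fun z => fderiv ℝ f z (stdOrthonormalBasis ℝ E j)) y
            (stdOrthonormalBasis ℝ E i)‖ₑ ^ 2) ^ (1 / 2 : ℝ) := by
  haveI : Nontrivial E := Module.nontrivial_of_finrank_pos (R := ℝ) (by rw [h3]; norm_num)
  set b := stdOrthonormalBasis ℝ E with hb
  set A : E → ℂ := ((𝓕⁻ ((memLp_two_of_smooth hf (hn 0)).toLp f) : Lp ℂ 2 (volume : Measure E)) :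
    E → ℂ) with hA
  set G : ℝ≥0∞ := ∑ i, ∫⁻ y, ‖fderiv ℝ f y (b i)‖ₑ ^ 2 with hG
  set H : ℝ≥0∞ := ∑ i, ∑ j, ∫⁻ y, ‖fderiv ℝ (fun z => fderiv ℝ f z (b j)) y (b i)‖ₑ ^ 2 with hH
  have hAm : AEStronglyMeasurable A volume := (Lp.memLp _).aestronglyMeasurable
  have hAe : AEMeasurable (fun ξ => ‖A ξ‖ₑ) volume := hAm.enorm
  have hπ : 0 < Real.pi := Real.pi_pos
  -- the weights
  set w₁ : E → ℝ≥0∞ := fun ξ => ENNReal.ofReal (2 * Real.pi * ‖ξ‖) with hw₁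
  set w₂ : E → ℝ≥0∞ := fun ξ => ENNReal.ofReal ((2 * Real.pi * ‖ξ‖) ^ 2) with hw₂
  have hw₁m : Measurable w₁ := ENNReal.measurable_ofReal.comp (by fun_prop)
  have hw₂m : Measurable w₂ := ENNReal.measurable_ofReal.comp (by fun_prop)
  -- LOW FREQUENCIES
  have hlow : ∫⁻ ξ in ball (0 : E) R, ‖A ξ‖ₑ ≤
      ENNReal.ofReal (R / Real.pi) ^ (1 / 2 : ℝ) * G ^ (1 / 2 : ℝ) := by
    have hne : ∀ᵐ ξ ∂((volume : Measure E).restrict (ball (0 : E) R)), ξ ≠ (0 : E) := by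
      have h0 : ((volume : Measure E).restrict (ball (0 : E) R)) {(0 : E)} = 0 := measure_singleton _
      filter_upwards [measure_eq_zero_iff_ae_notMem.1 h0] with ξ hξ
      simpa using hξ
    have hw : ∀ ξ : E, ξ ≠ 0 → w₁ ξ ≠ 0 ∧ w₁ ξ ≠ ⊤ := fun ξ hξ =>
      ⟨(ENNReal.ofReal_pos.2 (by positivity)).ne', ENNReal.ofReal_ne_top⟩
    have hstep : ∫⁻ ξ in ball (0 : E) R, ‖A ξ‖ₑ =
        ∫⁻ ξ in ball (0 : E) R, ((fun ξ => (w₁ ξ)⁻¹) * fun ξ => w₁ ξ * ‖A ξ‖ₑ) ξ := by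
      refine lintegral_congr_ae (hne.mono fun ξ hξ => ?_)
      simp only [Pi.mul_apply]
      rw [← mul_assoc, ENNReal.inv_mul_cancel (hw ξ hξ).1 (hw ξ hξ).2, one_mul]
    have hholder := ENNReal.lintegral_mul_le_Lp_mul_Lq ((volume : Measure E).restrict (ball (0 : E) R))
      Real.HolderConjugate.two_two hw₁m.inv.aemeasurable (hw₁m.aemeasurable.mul hAe.restrict)
    -- the radial factor
    have hrad : ∫⁻ ξ in ball (0 : E) R, (w₁ ξ)⁻¹ ^ (2 : ℝ) = ENNReal.ofReal (R / Real.pi) := by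
      have hc : ∀ᵐ ξ ∂((volume : Measure E).restrict (ball (0 : E) R)), (w₁ ξ)⁻¹ ^ (2 : ℝ) =
          ENNReal.ofReal (((2 * Real.pi) ^ 2)⁻¹) * ENNReal.ofReal ((‖ξ‖ ^ 2)⁻¹) := by
        filter_upwards [hne] with ξ hξ
        have hξ' : 0 < ‖ξ‖ := norm_pos_iff.2 hξ
        rw [ENNReal.rpow_two, hw₁]
        simp only
        rw [← ENNReal.ofReal_inv_of_pos (by positivity), ← ENNReal.ofReal_pow (by positivity),
          ← ENNReal.ofReal_mul (by positivity)]
        congr 1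
        field_simp
      rw [lintegral_congr_ae hc, lintegral_const_mul' _ _ ENNReal.ofReal_ne_top,
        lintegral_ball_norm_sq_inv h3 hR, ← ENNReal.ofReal_mul (by positivity)]
      congr 1
      field_simp
      ring
    -- the Plancherel factor
    have hpl : ∫⁻ ξ in ball (0 : E) R, (w₁ ξ * ‖A ξ‖ₑ) ^ (2 : ℝ) ≤ G := by
      refine (setLIntegral_le_lintegral _ _).trans (le_of_eq ?_)
      rw [hG, ← lintegral_weight_two_fourierInv hf hn]
      refine lintegral_congr fun ξ => ?_
      rw [ENNReal.rpow_two, mul_pow, hw₁]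
      simp only
      rw [← ENNReal.ofReal_pow (by positivity)]
    calc ∫⁻ ξ in ball (0 : E) R, ‖A ξ‖ₑ
        = ∫⁻ ξ in ball (0 : E) R, ((fun ξ => (w₁ ξ)⁻¹) * fun ξ => w₁ ξ * ‖A ξ‖ₑ) ξ := hstep
      _ ≤ (∫⁻ ξ in ball (0 : E) R, (w₁ ξ)⁻¹ ^ (2 : ℝ)) ^ (1 / (2 : ℝ)) *
            (∫⁻ ξ in ball (0 : E) R, (w₁ ξ * ‖A ξ‖ₑ) ^ (2 : ℝ)) ^ (1 / (2 : ℝ)) := hholder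
      _ ≤ ENNReal.ofReal (R / Real.pi) ^ (1 / 2 : ℝ) * G ^ (1 / 2 : ℝ) := by
          rw [hrad]
          gcongr
  -- HIGH FREQUENCIES
  have hhigh : ∫⁻ ξ in (ball (0 : E) R)ᶜ, ‖A ξ‖ₑ ≤
      ENNReal.ofReal (1 / (4 * Real.pi ^ 3 * R)) ^ (1 / 2 : ℝ) * H ^ (1 / 2 : ℝ) := by
    have hw : ∀ ξ : E, ξ ∈ (ball (0 : E) R)ᶜ → w₂ ξ ≠ 0 ∧ w₂ ξ ≠ ⊤ := fun ξ hξ => by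
      have hR' : R ≤ ‖ξ‖ := by simpa [mem_ball_zero_iff] using hξ
      have : 0 < ‖ξ‖ := hR.trans_le hR'
      exact ⟨(ENNReal.ofReal_pos.2 (by positivity)).ne', ENNReal.ofReal_ne_top⟩
    have hstep : ∫⁻ ξ in (ball (0 : E) R)ᶜ, ‖A ξ‖ₑ =
        ∫⁻ ξ in (ball (0 : E) R)ᶜ, ((fun ξ => (w₂ ξ)⁻¹) * fun ξ => w₂ ξ * ‖A ξ‖ₑ) ξ := by
      refine setLIntegral_congr_fun measurableSet_ball.compl fun ξ hξ => ?_
      simp only [Pi.mul_apply]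
      rw [← mul_assoc, ENNReal.inv_mul_cancel (hw ξ hξ).1 (hw ξ hξ).2, one_mul]
    have hholder := ENNReal.lintegral_mul_le_Lp_mul_Lq ((volume : Measure E).restrict (ball (0 : E) R)ᶜ)
      Real.HolderConjugate.two_two hw₂m.inv.aemeasurable (hw₂m.aemeasurable.mul hAe.restrict)
    have hrad : ∫⁻ ξ in (ball (0 : E) R)ᶜ, (w₂ ξ)⁻¹ ^ (2 : ℝ) =
        ENNReal.ofReal (1 / (4 * Real.pi ^ 3 * R)) := by
      have hc : ∀ ξ ∈ (ball (0 : E) R)ᶜ, (w₂ ξ)⁻¹ ^ (2 : ℝ) =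
          ENNReal.ofReal (((2 * Real.pi) ^ 4)⁻¹) * ENNReal.ofReal ((‖ξ‖ ^ 4)⁻¹) := by
        intro ξ hξ
        have hR' : R ≤ ‖ξ‖ := by simpa [mem_ball_zero_iff] using hξ
        have hξ' : 0 < ‖ξ‖ := hR.trans_le hR'
        rw [ENNReal.rpow_two, hw₂]
        simp only
        rw [← ENNReal.ofReal_inv_of_pos (by positivity), ← ENNReal.ofReal_pow (by positivity),
          ← ENNReal.ofReal_mul (by positivity)]
        congr 1
        field_simp
      rw [setLIntegral_congr_fun measurableSet_ball.compl hc, lintegral_const_mul' _ _ ENNReal.ofReal_ne_top,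
        lintegral_compl_ball_norm_pow_four_inv h3 hR, ← ENNReal.ofReal_mul (by positivity)]
      congr 1
      field_simp
      ring
    have hpl : ∫⁻ ξ in (ball (0 : E) R)ᶜ, (w₂ ξ * ‖A ξ‖ₑ) ^ (2 : ℝ) ≤ H := by
      refine (setLIntegral_le_lintegral _ _).trans (le_of_eq ?_)
      rw [hH, ← lintegral_weight_four_fourierInv hf hn]
      refine lintegral_congr fun ξ => ?_
      rw [ENNReal.rpow_two, mul_pow, hw₂]
      simp only
      rw [← ENNReal.ofReal_pow (by positivity), ← pow_mul]
    calc ∫⁻ ξ in (ball (0 : E) R)ᶜ, ‖A ξ‖ₑ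
        = ∫⁻ ξ in (ball (0 : E) R)ᶜ, ((fun ξ => (w₂ ξ)⁻¹) * fun ξ => w₂ ξ * ‖A ξ‖ₑ) ξ := hstep
      _ ≤ (∫⁻ ξ in (ball (0 : E) R)ᶜ, (w₂ ξ)⁻¹ ^ (2 : ℝ)) ^ (1 / (2 : ℝ)) *
            (∫⁻ ξ in (ball (0 : E) R)ᶜ, (w₂ ξ * ‖A ξ‖ₑ) ^ (2 : ℝ)) ^ (1 / (2 : ℝ)) := hholder
      _ ≤ ENNReal.ofReal (1 / (4 * Real.pi ^ 3 * R)) ^ (1 / 2 : ℝ) * H ^ (1 / 2 : ℝ) := by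
          rw [hrad]
          gcongr
  -- assembly
  calc ‖f x‖ₑ ≤ ∫⁻ ξ, ‖A ξ‖ₑ := enorm_le_lintegral_enorm_fourierInv hf hn x
    _ = (∫⁻ ξ in ball (0 : E) R, ‖A ξ‖ₑ) + ∫⁻ ξ in (ball (0 : E) R)ᶜ, ‖A ξ‖ₑ :=
        (lintegral_add_compl (fun ξ => ‖A ξ‖ₑ) measurableSet_ball).symm
    _ ≤ _ := add_le_add hlow hhigh

end Assembly

/-! ## §4 Optimising the radius: the explicit constant `√2/π` -/

section Optimise

omit [FiniteDimensional ℝ E] [MeasurableSpace E] [BorelSpace E] in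
/-- **The optimisation step.** If `t ≤ √(R/π) √g + √(1/(4π³R)) √h` for every `R > 0` (`g, h ≥ 0`), then
`t ≤ (√2/π) √(√g √h)` (`R = √h/(2π√g)` when `g, h > 0`; the limits `R → ∞`, `R → 0` otherwise).
[cite: SteinWeiss1971, Ch. I Thm. 2.3] -/
theorem le_agmon_const_of_forall_radius {t g h : ℝ} (hg : 0 ≤ g) (hh : 0 ≤ h)
    (H : ∀ R : ℝ, 0 < R →
      t ≤ Real.sqrt (R / Real.pi) * Real.sqrt g + Real.sqrt (1 / (4 * Real.pi ^ 3 * R)) * Real.sqrt h) :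
    t ≤ Real.sqrt 2 / Real.pi * Real.sqrt (Real.sqrt g * Real.sqrt h) := by
  have hπ : 0 < Real.pi := Real.pi_pos
  by_cases hg0 : g = 0
  · -- `t ≤ √(h/(4π³R))` for every `R`: let `R → ∞`
    subst hg0
    simp only [Real.sqrt_zero, mul_zero, zero_mul, zero_add] at H ⊢
    refine le_of_forall_pos_le_add fun ε hε => ?_
    set R : ℝ := h / (4 * Real.pi ^ 3 * ε ^ 2) + 1 with hR
    have hR0 : 0 < R := by positivity
    refine (H R hR0).trans ?_
    rw [zero_add, ← Real.sqrt_mul' _ hh, Real.sqrt_le_left hε.le]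
    rw [div_mul_eq_mul_div, one_mul, div_le_iff₀ (by positivity)]
    have : h = (R - 1) * (4 * Real.pi ^ 3 * ε ^ 2) := by rw [hR]; field_simp; ring
    nlinarith [sq_nonneg ε, pow_pos hπ 3]
  by_cases hh0 : h = 0
  · -- `t ≤ √(Rg/π)` for every `R`: let `R → 0`
    subst hh0
    simp only [Real.sqrt_zero, mul_zero, add_zero] at H ⊢
    refine le_of_forall_pos_le_add fun ε hε => ?_
    set R : ℝ := Real.pi * ε ^ 2 / (g + 1) with hR
    have hR0 : 0 < R := by positivity
    refine (H R hR0).trans ?_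
    rw [zero_add, ← Real.sqrt_mul' _ hg, Real.sqrt_le_left hε.le]
    rw [hR, show Real.pi * ε ^ 2 / (g + 1) / Real.pi * g = ε ^ 2 * (g / (g + 1)) by field_simp]
    have : g / (g + 1) ≤ 1 := by rw [div_le_one (by positivity)]; linarith
    nlinarith [sq_nonneg ε]
  -- the generic case: `R = √h / (2π √g)`
  have hgp : 0 < g := lt_of_le_of_ne hg (Ne.symm hg0)
  have hhp : 0 < h := lt_of_le_of_ne hh (Ne.symm hh0)
  have hsg : 0 < Real.sqrt g := Real.sqrt_pos.2 hgp
  have hsh : 0 < Real.sqrt h := Real.sqrt_pos.2 hhp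
  set q : ℝ := Real.sqrt g * Real.sqrt h with hq
  have hq0 : 0 < q := mul_pos hsg hsh
  set R : ℝ := Real.sqrt h / (2 * Real.pi * Real.sqrt g) with hR
  have hR0 : 0 < R := by positivity
  have hgg : Real.sqrt g * Real.sqrt g = g := Real.mul_self_sqrt hg
  have hhh : Real.sqrt h * Real.sqrt h = h := Real.mul_self_sqrt hh
  have e1 : R / Real.pi * g = q / (2 * Real.pi ^ 2) := by
    have : R / Real.pi * (Real.sqrt g * Real.sqrt g) = q / (2 * Real.pi ^ 2) := by
      rw [hR, hq]; field_simp
    rwa [hgg] at this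
  have e2 : 1 / (4 * Real.pi ^ 3 * R) * h = q / (2 * Real.pi ^ 2) := by
    have : 1 / (4 * Real.pi ^ 3 * R) * (Real.sqrt h * Real.sqrt h) = q / (2 * Real.pi ^ 2) := by
      rw [hR, hq]; field_simp; ring
    rwa [hhh] at this
  have e3 : Real.sqrt (q / (2 * Real.pi ^ 2)) = Real.sqrt q / (Real.sqrt 2 * Real.pi) := by
    rw [Real.sqrt_div' q (by positivity : (0 : ℝ) ≤ 2 * Real.pi ^ 2),
      Real.sqrt_mul' (2 : ℝ) (sq_nonneg Real.pi), Real.sqrt_sq hπ.le]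
  have hmain := H R hR0
  rw [← Real.sqrt_mul' _ hg, ← Real.sqrt_mul' _ hh, e1, e2, e3] at hmain
  have e4 : Real.sqrt q / (Real.sqrt 2 * Real.pi) + Real.sqrt q / (Real.sqrt 2 * Real.pi) =
      Real.sqrt 2 / Real.pi * Real.sqrt q := by
    have h2 : Real.sqrt 2 * Real.sqrt 2 = 2 := Real.mul_self_sqrt (by norm_num)
    have h2' : 0 < Real.sqrt 2 := Real.sqrt_pos.2 (by norm_num)
    field_simp
    nlinarith [h2]
  linarith [hmain, e4]

omit [FiniteDimensional ℝ E] [MeasurableSpace E] [BorelSpace E] in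
/-- `√(√g √h) = (g h)^{1/4}` for `g, h ≥ 0`. [cite: SteinWeiss1971, Ch. I Thm. 2.3] -/
theorem sqrt_sqrt_mul_sqrt_eq_rpow {g h : ℝ} (hg : 0 ≤ g) (hh : 0 ≤ h) :
    Real.sqrt (Real.sqrt g * Real.sqrt h) = (g * h) ^ (1 / 4 : ℝ) := by
  rw [← Real.sqrt_mul hg, Real.sqrt_eq_rpow, Real.sqrt_eq_rpow, ← Real.rpow_mul (mul_nonneg hg hh)]
  norm_num

end Optimise

end Summit.NavierStokesRegularity.NavierStokesRegularity.Theorems.AgmonExplicit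

end
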